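import Summits.CriticalPhenomena.PercolationContinuityZ3.Theorems.SoloInformedOuterplaneJordan
import HarnessLib

/-!
# Four anchors cover the targets of a convex drawing

Solo census (`solo-CriticalPhenomena-informed`), companion of `SoloInformedAnchoredGluing` and
`SoloInformedOuterplaneJordan`. Given boundary points `o ≠ b` of a circle (a linear order read
cyclically) and a finite target set `A ∌ o`, at most four targets — the extreme targets of the
order-intervals cut out by `o` and `b`, and `b` itself — *anchor* all of `A`: every target `a` is
assigned an anchor `c` with `a = c` or with `{o,a}`, `{c,b}` interlaced (`sep c o a ≠ sep b o a`),
so that by the combinatorial Jordan lemma every walk `o → a` meets every walk `c → b`.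
`anchors_of_lt` treats `o < b`, `anchors_of_gt` the mirror case.
-/

namespace Summit.CriticalPhenomena.PercolationContinuityZ3.Theorems

section Anchors

variable {V : Type*} [LinearOrder V]

/-- Orientation `o < b`: the targets strictly between `o` and `b` are anchored by the least of
them, those below `o` by the greatest of them, those above `b` by the greatest of them, and `b`
(if a target) by itself. -/
theorem anchors_of_lt (A : Finset V) {o b : V} (ho : o ∉ A) (hob : o < b) :
    ∃ Anc : Finset V, Anc ⊆ A ∧ Anc.card ≤ 4 ∧ ∃ part : V → Finset V,
      (∀ a ∈ A, ∃ c ∈ Anc, a ∈ part c) ∧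
      (∀ c ∈ Anc, ∀ a ∈ part c, a = c ∨ sep c o a ≠ sep b o a) := by
  classical
  set G1 : Finset V := A.filter (fun a => o < a ∧ a < b) with hG1
  set G2 : Finset V := A.filter (fun a => a < o) with hG2
  set G3 : Finset V := A.filter (fun a => b < a) with hG3
  set G4 : Finset V := A.filter (fun a => a = b) with hG4
  set M1 : Finset V := G1.filter (fun c => ∀ a ∈ G1, c ≤ a) with hM1
  set M2 : Finset V := G2.filter (fun c => ∀ a ∈ G2, a ≤ c) with hM2
  set M3 : Finset V := G3.filter (fun c => ∀ a ∈ G3, a ≤ c) with hM3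
  refine ⟨M1 ∪ M2 ∪ M3 ∪ G4, ?_, ?_,
    fun c => if c ∈ G1 then G1 else if c ∈ G2 then G2 else if c ∈ G3 then G3 else G4, ?_, ?_⟩
  · intro c hc
    rcases Finset.mem_union.1 hc with hc | hc
    · rcases Finset.mem_union.1 hc with hc | hc
      · rcases Finset.mem_union.1 hc with hc | hc
        · exact (Finset.mem_filter.1 (Finset.mem_filter.1 hc).1).1
        · exact (Finset.mem_filter.1 (Finset.mem_filter.1 hc).1).1
      · exact (Finset.mem_filter.1 (Finset.mem_filter.1 hc).1).1
    · exact (Finset.mem_filter.1 hc).1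
  · have c1 : M1.card ≤ 1 := Finset.card_le_one.2 fun x hx y hy =>
      le_antisymm ((Finset.mem_filter.1 hx).2 y (Finset.mem_filter.1 hy).1)
        ((Finset.mem_filter.1 hy).2 x (Finset.mem_filter.1 hx).1)
    have c2 : M2.card ≤ 1 := Finset.card_le_one.2 fun x hx y hy =>
      le_antisymm ((Finset.mem_filter.1 hy).2 x (Finset.mem_filter.1 hx).1)
        ((Finset.mem_filter.1 hx).2 y (Finset.mem_filter.1 hy).1)
    have c3 : M3.card ≤ 1 := Finset.card_le_one.2 fun x hx y hy =>
      le_antisymm ((Finset.mem_filter.1 hy).2 x (Finset.mem_filter.1 hx).1)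
        ((Finset.mem_filter.1 hx).2 y (Finset.mem_filter.1 hy).1)
    have c4 : G4.card ≤ 1 := Finset.card_le_one.2 fun x hx y hy => by
      rw [(Finset.mem_filter.1 hx).2, (Finset.mem_filter.1 hy).2]
    calc (M1 ∪ M2 ∪ M3 ∪ G4).card ≤ (M1 ∪ M2 ∪ M3).card + G4.card := Finset.card_union_le _ _
      _ ≤ (M1 ∪ M2).card + M3.card + G4.card := by
          gcongr; exact Finset.card_union_le _ _
      _ ≤ M1.card + M2.card + M3.card + G4.card := by
          gcongr; exact Finset.card_union_le _ _
      _ ≤ 1 + 1 + 1 + 1 := by gcongr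
      _ = 4 := rfl
  · intro a ha
    have hao : a ≠ o := fun h => ho (h ▸ ha)
    rcases lt_trichotomy a o with hlt | heq | hgt
    · have haG2 : a ∈ G2 := Finset.mem_filter.2 ⟨ha, hlt⟩
      obtain ⟨c, hcG2, hcmax⟩ := G2.exists_max_image id ⟨a, haG2⟩
      have hcM2 : c ∈ M2 := Finset.mem_filter.2 ⟨hcG2, fun a' ha' => hcmax a' ha'⟩
      have hco : c < o := (Finset.mem_filter.1 hcG2).2
      have h1 : c ∉ G1 := fun h => lt_asymm hco (Finset.mem_filter.1 h).2.1
      refine ⟨c, Finset.mem_union_left _ (Finset.mem_union_left _ (Finset.mem_union_right _ hcM2)), ?_⟩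
      dsimp only
      rw [if_neg h1, if_pos hcG2]
      exact haG2
    · exact absurd heq hao
    · rcases lt_trichotomy a b with hab | hab | hab
      · have haG1 : a ∈ G1 := Finset.mem_filter.2 ⟨ha, hgt, hab⟩
        obtain ⟨c, hcG1, hcmin⟩ := G1.exists_min_image id ⟨a, haG1⟩
        have hcM1 : c ∈ M1 := Finset.mem_filter.2 ⟨hcG1, fun a' ha' => hcmin a' ha'⟩
        refine ⟨c, Finset.mem_union_left _ (Finset.mem_union_left _ (Finset.mem_union_left _ hcM1)), ?_⟩
        dsimp only
        rw [if_pos hcG1]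
        exact haG1
      · subst hab
        have haG4 : a ∈ G4 := Finset.mem_filter.2 ⟨ha, rfl⟩
        have h1 : a ∉ G1 := fun h => lt_irrefl _ (Finset.mem_filter.1 h).2.2
        have h2 : a ∉ G2 := fun h => lt_asymm hob (Finset.mem_filter.1 h).2
        have h3 : a ∉ G3 := fun h => lt_irrefl _ (Finset.mem_filter.1 h).2
        refine ⟨a, Finset.mem_union_right _ haG4, ?_⟩
        dsimp only
        rw [if_neg h1, if_neg h2, if_neg h3]
        exact haG4
      · have haG3 : a ∈ G3 := Finset.mem_filter.2 ⟨ha, hab⟩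
        obtain ⟨c, hcG3, hcmax⟩ := G3.exists_max_image id ⟨a, haG3⟩
        have hcM3 : c ∈ M3 := Finset.mem_filter.2 ⟨hcG3, fun a' ha' => hcmax a' ha'⟩
        have hbc : b < c := (Finset.mem_filter.1 hcG3).2
        have h1 : c ∉ G1 := fun h => lt_asymm hbc (Finset.mem_filter.1 h).2.2
        have h2 : c ∉ G2 := fun h => lt_asymm (hob.trans hbc) (Finset.mem_filter.1 h).2
        refine ⟨c, Finset.mem_union_left _ (Finset.mem_union_right _ hcM3), ?_⟩
        dsimp only
        rw [if_neg h1, if_neg h2, if_pos hcG3]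
        exact haG3
  · intro c hc a ha
    dsimp only at ha
    by_cases h1 : c ∈ G1
    · rw [if_pos h1] at ha
      have hoc : o < c := (Finset.mem_filter.1 h1).2.1
      have hcb : c < b := (Finset.mem_filter.1 h1).2.2
      have hcM1 : c ∈ M1 := by
        rcases Finset.mem_union.1 hc with hc | hc
        · rcases Finset.mem_union.1 hc with hc | hc
          · rcases Finset.mem_union.1 hc with hc | hc
            · exact hc
            · exact absurd (Finset.mem_filter.1 (Finset.mem_filter.1 hc).1).2 (lt_asymm hoc)
          · exact absurd (Finset.mem_filter.1 (Finset.mem_filter.1 hc).1).2 (lt_asymm hcb)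
        · exact absurd (Finset.mem_filter.1 hc).2 (ne_of_lt hcb)
      rcases eq_or_lt_of_le ((Finset.mem_filter.1 hcM1).2 a ha) with hca | hca
      · exact Or.inl hca.symm
      · exact Or.inr (interlaced₁ hoc hca (Finset.mem_filter.1 ha).2.2)
    by_cases h2 : c ∈ G2
    · rw [if_neg h1, if_pos h2] at ha
      have hco : c < o := (Finset.mem_filter.1 h2).2
      have hcM2 : c ∈ M2 := by
        rcases Finset.mem_union.1 hc with hc | hc
        · rcases Finset.mem_union.1 hc with hc | hc
          · rcases Finset.mem_union.1 hc with hc | hc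
            · exact absurd (Finset.mem_filter.1 hc).1 h1
            · exact hc
          · exact absurd (Finset.mem_filter.1 (Finset.mem_filter.1 hc).1).2
              (lt_asymm (hco.trans hob))
        · exact absurd (Finset.mem_filter.1 hc).2 (ne_of_lt (hco.trans hob))
      rcases eq_or_lt_of_le ((Finset.mem_filter.1 hcM2).2 a ha) with hac | hac
      · exact Or.inl hac
      · exact Or.inr (interlaced₂ hac hco hob)
    by_cases h3 : c ∈ G3
    · rw [if_neg h1, if_neg h2, if_pos h3] at ha
      have hbc : b < c := (Finset.mem_filter.1 h3).2
      have hcM3 : c ∈ M3 := by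
        rcases Finset.mem_union.1 hc with hc | hc
        · rcases Finset.mem_union.1 hc with hc | hc
          · rcases Finset.mem_union.1 hc with hc | hc
            · exact absurd (Finset.mem_filter.1 hc).1 h1
            · exact absurd (Finset.mem_filter.1 hc).1 h2
          · exact hc
        · exact absurd (Finset.mem_filter.1 hc).2 (ne_of_gt hbc)
      rcases eq_or_lt_of_le ((Finset.mem_filter.1 hcM3).2 a ha) with hac | hac
      · exact Or.inl hac
      · exact Or.inr (interlaced₃ hob (Finset.mem_filter.1 ha).2 hac)
    · rw [if_neg h1, if_neg h2, if_neg h3] at ha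
      have hcG4 : c ∈ G4 := by
        rcases Finset.mem_union.1 hc with hc | hc
        · rcases Finset.mem_union.1 hc with hc | hc
          · rcases Finset.mem_union.1 hc with hc | hc
            · exact absurd (Finset.mem_filter.1 hc).1 h1
            · exact absurd (Finset.mem_filter.1 hc).1 h2
          · exact absurd (Finset.mem_filter.1 hc).1 h3
        · exact hc
      exact Or.inl (((Finset.mem_filter.1 ha).2).trans ((Finset.mem_filter.1 hcG4).2).symm)

/-- Orientation `b < o` (mirror image of `anchors_of_lt`). -/
theorem anchors_of_gt (A : Finset V) {o b : V} (ho : o ∉ A) (hbo : b < o) :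
    ∃ Anc : Finset V, Anc ⊆ A ∧ Anc.card ≤ 4 ∧ ∃ part : V → Finset V,
      (∀ a ∈ A, ∃ c ∈ Anc, a ∈ part c) ∧
      (∀ c ∈ Anc, ∀ a ∈ part c, a = c ∨ sep c o a ≠ sep b o a) := by
  classical
  set G1 : Finset V := A.filter (fun a => b < a ∧ a < o) with hG1
  set G2 : Finset V := A.filter (fun a => o < a) with hG2
  set G3 : Finset V := A.filter (fun a => a < b) with hG3
  set G4 : Finset V := A.filter (fun a => a = b) with hG4
  set M1 : Finset V := G1.filter (fun c => ∀ a ∈ G1, a ≤ c) with hM1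
  set M2 : Finset V := G2.filter (fun c => ∀ a ∈ G2, c ≤ a) with hM2
  set M3 : Finset V := G3.filter (fun c => ∀ a ∈ G3, c ≤ a) with hM3
  refine ⟨M1 ∪ M2 ∪ M3 ∪ G4, ?_, ?_,
    fun c => if c ∈ G1 then G1 else if c ∈ G2 then G2 else if c ∈ G3 then G3 else G4, ?_, ?_⟩
  · intro c hc
    rcases Finset.mem_union.1 hc with hc | hc
    · rcases Finset.mem_union.1 hc with hc | hc
      · rcases Finset.mem_union.1 hc with hc | hc
        · exact (Finset.mem_filter.1 (Finset.mem_filter.1 hc).1).1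
        · exact (Finset.mem_filter.1 (Finset.mem_filter.1 hc).1).1
      · exact (Finset.mem_filter.1 (Finset.mem_filter.1 hc).1).1
    · exact (Finset.mem_filter.1 hc).1
  · have c1 : M1.card ≤ 1 := Finset.card_le_one.2 fun x hx y hy =>
      le_antisymm ((Finset.mem_filter.1 hy).2 x (Finset.mem_filter.1 hx).1)
        ((Finset.mem_filter.1 hx).2 y (Finset.mem_filter.1 hy).1)
    have c2 : M2.card ≤ 1 := Finset.card_le_one.2 fun x hx y hy =>
      le_antisymm ((Finset.mem_filter.1 hx).2 y (Finset.mem_filter.1 hy).1)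
        ((Finset.mem_filter.1 hy).2 x (Finset.mem_filter.1 hx).1)
    have c3 : M3.card ≤ 1 := Finset.card_le_one.2 fun x hx y hy =>
      le_antisymm ((Finset.mem_filter.1 hx).2 y (Finset.mem_filter.1 hy).1)
        ((Finset.mem_filter.1 hy).2 x (Finset.mem_filter.1 hx).1)
    have c4 : G4.card ≤ 1 := Finset.card_le_one.2 fun x hx y hy => by
      rw [(Finset.mem_filter.1 hx).2, (Finset.mem_filter.1 hy).2]
    calc (M1 ∪ M2 ∪ M3 ∪ G4).card ≤ (M1 ∪ M2 ∪ M3).card + G4.card := Finset.card_union_le _ _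
      _ ≤ (M1 ∪ M2).card + M3.card + G4.card := by
          gcongr; exact Finset.card_union_le _ _
      _ ≤ M1.card + M2.card + M3.card + G4.card := by
          gcongr; exact Finset.card_union_le _ _
      _ ≤ 1 + 1 + 1 + 1 := by gcongr
      _ = 4 := rfl
  · intro a ha
    have hao : a ≠ o := fun h => ho (h ▸ ha)
    rcases lt_trichotomy a o with hlt | heq | hgt
    · rcases lt_trichotomy a b with hab | hab | hab
      · have haG3 : a ∈ G3 := Finset.mem_filter.2 ⟨ha, hab⟩
        obtain ⟨c, hcG3, hcmin⟩ := G3.exists_min_image id ⟨a, haG3⟩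
        have hcM3 : c ∈ M3 := Finset.mem_filter.2 ⟨hcG3, fun a' ha' => hcmin a' ha'⟩
        have hcb : c < b := (Finset.mem_filter.1 hcG3).2
        have h1 : c ∉ G1 := fun h => lt_asymm hcb (Finset.mem_filter.1 h).2.1
        have h2 : c ∉ G2 := fun h => lt_asymm (hcb.trans hbo) (Finset.mem_filter.1 h).2
        refine ⟨c, Finset.mem_union_left _ (Finset.mem_union_right _ hcM3), ?_⟩
        dsimp only
        rw [if_neg h1, if_neg h2, if_pos hcG3]
        exact haG3
      · subst hab
        have haG4 : a ∈ G4 := Finset.mem_filter.2 ⟨ha, rfl⟩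
        have h1 : a ∉ G1 := fun h => lt_irrefl _ (Finset.mem_filter.1 h).2.1
        have h2 : a ∉ G2 := fun h => lt_asymm hbo (Finset.mem_filter.1 h).2
        have h3 : a ∉ G3 := fun h => lt_irrefl _ (Finset.mem_filter.1 h).2
        refine ⟨a, Finset.mem_union_right _ haG4, ?_⟩
        dsimp only
        rw [if_neg h1, if_neg h2, if_neg h3]
        exact haG4
      · have haG1 : a ∈ G1 := Finset.mem_filter.2 ⟨ha, hab, hlt⟩
        obtain ⟨c, hcG1, hcmax⟩ := G1.exists_max_image id ⟨a, haG1⟩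
        have hcM1 : c ∈ M1 := Finset.mem_filter.2 ⟨hcG1, fun a' ha' => hcmax a' ha'⟩
        refine ⟨c, Finset.mem_union_left _ (Finset.mem_union_left _ (Finset.mem_union_left _ hcM1)), ?_⟩
        dsimp only
        rw [if_pos hcG1]
        exact haG1
    · exact absurd heq hao
    · have haG2 : a ∈ G2 := Finset.mem_filter.2 ⟨ha, hgt⟩
      obtain ⟨c, hcG2, hcmin⟩ := G2.exists_min_image id ⟨a, haG2⟩
      have hcM2 : c ∈ M2 := Finset.mem_filter.2 ⟨hcG2, fun a' ha' => hcmin a' ha'⟩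
      have hoc : o < c := (Finset.mem_filter.1 hcG2).2
      have h1 : c ∉ G1 := fun h => lt_asymm hoc (Finset.mem_filter.1 h).2.2
      refine ⟨c, Finset.mem_union_left _ (Finset.mem_union_left _ (Finset.mem_union_right _ hcM2)), ?_⟩
      dsimp only
      rw [if_neg h1, if_pos hcG2]
      exact haG2
  · intro c hc a ha
    dsimp only at ha
    by_cases h1 : c ∈ G1
    · rw [if_pos h1] at ha
      have hbc : b < c := (Finset.mem_filter.1 h1).2.1
      have hco : c < o := (Finset.mem_filter.1 h1).2.2
      have hcM1 : c ∈ M1 := by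
        rcases Finset.mem_union.1 hc with hc | hc
        · rcases Finset.mem_union.1 hc with hc | hc
          · rcases Finset.mem_union.1 hc with hc | hc
            · exact hc
            · exact absurd (Finset.mem_filter.1 (Finset.mem_filter.1 hc).1).2 (lt_asymm hco)
          · exact absurd (Finset.mem_filter.1 (Finset.mem_filter.1 hc).1).2 (lt_asymm hbc)
        · exact absurd (Finset.mem_filter.1 hc).2 (ne_of_gt hbc)
      rcases eq_or_lt_of_le ((Finset.mem_filter.1 hcM1).2 a ha) with hac | hac
      · exact Or.inl hac
      · exact Or.inr (interlaced₄ (Finset.mem_filter.1 ha).2.1 hac hco)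
    by_cases h2 : c ∈ G2
    · rw [if_neg h1, if_pos h2] at ha
      have hoc : o < c := (Finset.mem_filter.1 h2).2
      have hcM2 : c ∈ M2 := by
        rcases Finset.mem_union.1 hc with hc | hc
        · rcases Finset.mem_union.1 hc with hc | hc
          · rcases Finset.mem_union.1 hc with hc | hc
            · exact absurd (Finset.mem_filter.1 hc).1 h1
            · exact hc
          · exact absurd (Finset.mem_filter.1 (Finset.mem_filter.1 hc).1).2
              (lt_asymm (hbo.trans hoc))
        · exact absurd (Finset.mem_filter.1 hc).2 (ne_of_gt (hbo.trans hoc))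
      rcases eq_or_lt_of_le ((Finset.mem_filter.1 hcM2).2 a ha) with hca | hca
      · exact Or.inl hca.symm
      · exact Or.inr (interlaced₅ hbo hoc hca)
    by_cases h3 : c ∈ G3
    · rw [if_neg h1, if_neg h2, if_pos h3] at ha
      have hcb : c < b := (Finset.mem_filter.1 h3).2
      have hcM3 : c ∈ M3 := by
        rcases Finset.mem_union.1 hc with hc | hc
        · rcases Finset.mem_union.1 hc with hc | hc
          · rcases Finset.mem_union.1 hc with hc | hc
            · exact absurd (Finset.mem_filter.1 hc).1 h1
            · exact absurd (Finset.mem_filter.1 hc).1 h2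
          · exact hc
        · exact absurd (Finset.mem_filter.1 hc).2 (ne_of_lt hcb)
      rcases eq_or_lt_of_le ((Finset.mem_filter.1 hcM3).2 a ha) with hca | hca
      · exact Or.inl hca.symm
      · exact Or.inr (interlaced₆ hca (Finset.mem_filter.1 ha).2 hbo)
    · rw [if_neg h1, if_neg h2, if_neg h3] at ha
      have hcG4 : c ∈ G4 := by
        rcases Finset.mem_union.1 hc with hc | hc
        · rcases Finset.mem_union.1 hc with hc | hc
          · rcases Finset.mem_union.1 hc with hc | hc
            · exact absurd (Finset.mem_filter.1 hc).1 h1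
            · exact absurd (Finset.mem_filter.1 hc).1 h2
          · exact absurd (Finset.mem_filter.1 hc).1 h3
        · exact hc
      exact Or.inl (((Finset.mem_filter.1 ha).2).trans ((Finset.mem_filter.1 hcG4).2).symm)

end Anchors

end Summit.CriticalPhenomena.PercolationContinuityZ3.Theorems
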